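import Summits.QuantumFields.BalabanUV.Beta.GaugeMultiplierBlockMean

/-!
# Road BF-x, K-R1-SPEC v2 (D-Π): `Π_bm`-BLINDNESS TO BLOCK-MEAN-FREE GAUGE LEGS AT KERNEL LEVEL — the windowed-matrix twin of
# `axProjBmAt_dz`, `comp (trK piKBm) G = 0` ∕ `coDressKBmAt ρ N G = 0` for kernels whose field columns are gradients of block-sum-free
# functions, and `coDressKBmAt ρ N (K − G) = coDressKBmAt ρ N K`

HONEST DEPENDENCY (page 1, mandatory): continuum YM on T⁴ ⇐ BetaPertH ∧ nine spine estimates (0/9 proved); BetaPertH ⇐ (D1) ∧ (D4) ∧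
CAP+tail; G-an2-4 gates asym, D1 and NE2/3/4.  HONEST FRAMING (cell contract, verbatim): «discharging `BetaPertH` makes Bałaban's UV
stability UNCONDITIONAL — a real constructive-QFT result; it is NOT the continuum limit and NOT the Clay problem.»  THIS MODULE is kernel
algebra about the CELL'S OWN block-mean projector `Π_bm` (`AxialProjectorBlockMean.axProjBmAt`, matrix `AxialDressingRooted.pmBm`, kernel
`piKBm`, co-dressing `coDressKBmAt ρ N K = piKBmᵀ ∘ K ∘ piKBm`): [folklore] only, no `def`, no `def … : Prop`, nothing cited, 0 sorry.  It asserts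
NO line of the road's dictionary (K-R1-SPEC v2 (D-H)∕(D-Γ), e.g. `Gam = Γ_R − d∘𝔅∘δ` — NOT in the tree, debt X₁); it only supplies the socket
by which such a line makes the bi-Laplacian gauge term drop out of the co-dressed legs of the literal of record.  0∕4 binders of row D1
(hW, hR, D1Tel, D1Rep) discharged; NOT D1, NOT BetaPertH, NOT continuum, NOT Clay.

ABSOLUTE RULE (cell charter, verbatim): «No internally-minted statement may enter as a cited fact. Every hypothesis is either kernel-proved
in this package or a verbatim quotation of a PUBLISHED theorem with page reference. The manuscript(s) under audit are NOT citable for their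
own disputed steps — they are the thing under adjudication; programme-internal (2001/route/tribunal) claims are never citable.»

WHY (road «BF-x», `HOME/b2b-balaban-beta-d1-p2/K-R1-SPEC-v2.md` §2 (D-Π), §5 step (2); `LEAVES-BFx.md` INTEGRATION #9 sub-row
«D1-BFx-BM-BLIND»).  The legs of the literal of record `RowD1JointEnd.JsRowD1Pin` are `coDressKBmAt ρ_c n (KInv n)`
(`FirstStepPinned.TshotOf_JcPin_codressed`).  The block-mean-normalised comb projector kills exactly the gradients of functions with
block-constant block means (`GaugeMultiplierBlockMean.axProjBmAt_dz : Π_bm (dz f) = dz (blockMeanAt N f)`), so a gauge term `d∘X∘δ` with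
block-sum-free columns of `X` (the 𝔫_av gauge legs) is invisible to the co-dressing.  The kernel calculus (`ExpKernelCalculus.comp`,
windowed `piKBm`) needs this at MATRIX level and for infinitely supported `f`; the bridge is summation by parts on the finite window against
an2's `codiff₁_rowBm : codiff₁ (rowBm ρ N κ′ x) u = dz (blockMeanAt N 𝟙_u) κ′ x`.

CONTENT.
* §1 (matrix level, EVERY `f : Form0`, no support hypothesis) `tsum_ite_blk_eq_blockSum`; `pmBm_eq_zero_of_not_mem_window`;
  **`tsum_pmBm_dz_eq_tsum_codiff`** (by parts: `Σ_z Σ_κ pmBm ρ N κ′ x κ z · dz f κ z = Σ_u codiff₁ (rowBm ρ N κ′ x) u · f u`);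
  **`tsum_codiff_rowBm_mul`** (`= dz (blockMeanAt N f) κ′ x`); **`tsum_pmBm_dz`** and its window form **`sum_window_pmBm_dz`**
  (`Σ_{v ∈ cube} Σ_κ pmBm ρ N κ′ x κ (x−v) · dz f κ (x−v) = dz (blockMeanAt N f) κ′ x`); `dz_blockMeanAt_eq_zero_of_blockSum_eq`
  (constant block sums ⇒ `dz (blockMeanAt N f) = 0`), `axProjBmAt_dz_eq_zero_of_blockSum_eq` (form level), `sum_window_pmBm_dz_eq_zero_of_blockSum_eq`.
* §2 (kernel level) `comp_trK_piKBm_inr` (multiplier rows pass through); **`comp_trK_piKBm_inl_of_col_eq_dz`** (kernel twin of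
  `axProjBmAt_dz`: a field column equal to `dz f` is mapped to `dz (blockMeanAt N f)`); **`comp_trK_piKBm_eq_zero_of_gradCols`**
  (`comp (trK (piKBm ρ N)) G = 0` when every column of `G`, read on its field rows, is the gradient of a function with constant block sums and
  the multiplier rows of `G` vanish); **`coDressKBmAt_eq_zero_of_gradCols`**; the second-leg ∕ transposed form **`comp_piKBm_eq_zero_of_gradRows`**;
  **`coDressKBmAt_sub_of_gradCols`** ∕ `coDressKBmAt_add_of_gradCols` (`coDressKBmAt ρ N (K − G) = coDressKBmAt ρ N K` for tame `K`, `G` —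
  `TameKernelCalculus.comp_sub_right_tame`).
* §3 (the (D-Π) shape verbatim) **`coDressKBmAt_biGrad_eq_zero`**: for a scalar kernel `X` with block-sum-free columns, the kernel whose
  field–field block is the bi-gradient `(κ,x;l,y) ↦ X (x+e_κ) (y+e_l) − X (x+e_κ) y − X x (y+e_l) + X x y` (`= d∘X∘δ`) and whose other blocks
  vanish is killed by `piKBmᵀ ∘ ·`, by `· ∘ piKBm` (block-sum-free ROWS), and by the co-dressing; **`coDressKBmAt_sub_biGrad`**
  (`coDressKBmAt ρ N (K − G) = coDressKBmAt ρ N K`, the socket for the dictionary line (D-Γ)).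
Unit `b2b-balaban-beta-d1-formalise-leaf-06` (gen 6), 2026-08-20; claim table `HOME/b2b-balaban-beta-d1-p2/LEAVES-BFx.md` sub-row «D1-BFx-BM-BLIND».
-/

open Finset
open scoped BigOperators
open Literature.MathematicalPhysics.QuantumFieldTheory
open Literature.MathematicalPhysics.QuantumFieldTheory.Balaban1983to89
open Literature.MathematicalPhysics.QuantumFieldTheory.Balaban1983to89.Beta
open ExpKernelCalculus (MKer comp)
open AffineAveraging (Form0 Form1 box toSite unitVec dz codiff₁ blockSum)
open AveragingContours (blk off blk_block blk_add_off off_mem_box)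
open OneStepResolventKernel (Fib)
open Summit.QuantumFields.BalabanUV.Beta.TameKernelCalculus
open Summit.QuantumFields.BalabanUV.Beta.AxialProjectorBlockMean (blockMeanAt axProjBmAt)
open Summit.QuantumFields.BalabanUV.Beta.AxialDressingRooted (cube mem_cube pmBm piKBm sum_piKBm_col_inl window_of_pmBm_ne_zero
  comp_piKBm_inr tsum_window' coDressKBmAt coDressKBmAt_eq spr_piKBm spr_trK_piKBm)
open Summit.QuantumFields.BalabanUV.Beta.BorderedHessian (rowBm rowBm_apply ind codiff₁_rowBm blockMeanAt_ind axProjBmAt_dz)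

namespace Summit.QuantumFields.BalabanUV.Beta.D1BFx.BlockMeanBlindness

noncomputable section

variable {d : ℕ} {N : ℕ}

/-! ## §1 Matrix level: a row of `Π_bm` paired with a gradient, by parts on the finite window -/

section Matrix

/-- [folklore] Off the block `y` the block-indicator-weighted function vanishes outside the image of the box. -/
theorem ite_blk_eq_zero_of_not_mem (hN : 1 ≤ N) (g : Form0 (d + 1) ℝ) (y u : Fin (d + 1) → ℤ)
    (hu : u ∉ (box (d + 1) N).image fun b => (N : ℤ) • y + toSite b) : (if blk N u = y then g u else 0) = 0 := by
  rw [if_neg]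
  intro h
  exact hu (Finset.mem_image.2 ⟨off N u, off_mem_box hN u, by rw [← h, blk_add_off hN u]⟩)

/-- [folklore] **A LATTICE SUM OF A FUNCTION CUT TO ONE BLOCK IS THE BLOCK SUM**: `Σ'_u [blk N u = y]·g u = blockSum N g y` (`N ≥ 1`). -/
theorem tsum_ite_blk_eq_blockSum (hN : 1 ≤ N) (g : Form0 (d + 1) ℝ) (y : Fin (d + 1) → ℤ) :
    ∑' u, (if blk N u = y then g u else 0) = blockSum N g y := by
  classical
  have hinj : Set.InjOn (fun b : Fin (d + 1) → ℕ => (N : ℤ) • y + toSite b) ↑(box (d + 1) N) := by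
    intro b _ b' _ h
    have h2 : toSite b = toSite b' := add_left_cancel h
    funext i
    have := congr_fun h2 i
    simp only [toSite] at this
    exact_mod_cast this
  rw [tsum_eq_sum (s := (box (d + 1) N).image fun b => (N : ℤ) • y + toSite b) (fun u hu => ite_blk_eq_zero_of_not_mem hN g y u hu),
    Finset.sum_image hinj]
  unfold AffineAveraging.blockSum
  refine Finset.sum_congr rfl fun b hb => ?_
  rw [if_pos (blk_block y hb)]

/-- [folklore] The block-cut function is summable. -/
theorem summable_ite_blk (hN : 1 ≤ N) (g : Form0 (d + 1) ℝ) (y : Fin (d + 1) → ℤ) :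
    Summable fun u => (if blk N u = y then g u else 0) :=
  summable_of_ne_finset_zero (fun u hu => ite_blk_eq_zero_of_not_mem hN g y u hu)

/-- [folklore] **SUPPORT OF A ROW OF `Π_bm` ON THE WINDOW** (in-block root): `pmBm (toSite r) N κ′ x κ z = 0` unless `x − z ∈ cube`. -/
theorem pmBm_eq_zero_of_not_mem_window (hN : 1 ≤ N) {r : Fin (d + 1) → ℕ} (hr : r ∈ box (d + 1) N) (κ' : Fin (d + 1))
    (x : Fin (d + 1) → ℤ) (κ : Fin (d + 1)) (z : Fin (d + 1) → ℤ) (h : x - z ∉ cube (d + 1) N) :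
    pmBm (toSite r) N κ' x κ z = 0 := by
  by_contra hne
  exact h (window_of_pmBm_ne_zero hN hr hne)

/-- [folklore] Off the window set the row vanishes (Finset form of the support). -/
theorem pmBm_eq_zero_of_not_mem_image (hN : 1 ≤ N) {r : Fin (d + 1) → ℕ} (hr : r ∈ box (d + 1) N) (κ' : Fin (d + 1))
    (x : Fin (d + 1) → ℤ) (κ : Fin (d + 1)) {z : Fin (d + 1) → ℤ} (hz : z ∉ (cube (d + 1) N).image fun v => x - v) :
    pmBm (toSite r) N κ' x κ z = 0 := by
  classical
  refine pmBm_eq_zero_of_not_mem_window hN hr κ' x κ z fun hmem => hz ?_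
  exact Finset.mem_image.2 ⟨x - z, hmem, sub_sub_cancel x z⟩

/-- [folklore] **SUMMATION BY PARTS AGAINST A ROW OF `Π_bm`** (in-block root, EVERY `f`): the row `(κ′, x)` of `Π_bm` is windowed, so
`Σ'_z Σ_κ pmBm ρ N κ′ x κ z · (dz f) κ z = Σ'_u codiff₁ (rowBm ρ N κ′ x) u · f u` (all sums finite). -/
theorem tsum_pmBm_dz_eq_tsum_codiff (hN : 1 ≤ N) {r : Fin (d + 1) → ℕ} (hr : r ∈ box (d + 1) N) (f : Form0 (d + 1) ℝ)
    (κ' : Fin (d + 1)) (x : Fin (d + 1) → ℤ) :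
    ∑' z, ∑ κ : Fin (d + 1), pmBm (toSite r) N κ' x κ z * dz f κ z =
      ∑' u, codiff₁ (rowBm (toSite r) N κ' x) u * f u := by
  classical
  set S : Finset (Fin (d + 1) → ℤ) := (cube (d + 1) N).image fun v => x - v with hSdef
  have hS : ∀ z, z ∉ S → ∀ κ, pmBm (toSite r) N κ' x κ z = 0 := fun z hz κ =>
    pmBm_eq_zero_of_not_mem_image hN hr κ' x κ (by rw [hSdef] at hz; exact hz)
  -- summability of the three finitely supported families
  have h1 : ∀ κ : Fin (d + 1), Summable fun z => pmBm (toSite r) N κ' x κ z * f (z + unitVec κ) := fun κ =>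
    summable_of_ne_finset_zero (s := S) fun z hz => by rw [hS z hz κ, zero_mul]
  have h2 : ∀ κ : Fin (d + 1), Summable fun z => pmBm (toSite r) N κ' x κ z * f z := fun κ =>
    summable_of_ne_finset_zero (s := S) fun z hz => by rw [hS z hz κ, zero_mul]
  have h3 : ∀ κ : Fin (d + 1), Summable fun u => pmBm (toSite r) N κ' x κ (u - unitVec κ) * f u := fun κ =>
    summable_of_ne_finset_zero (s := S.image fun z => z + unitVec κ) fun u hu => by
      have hu' : u - unitVec κ ∉ S := fun h => hu (Finset.mem_image.2 ⟨_, h, sub_add_cancel u _⟩)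
      rw [hS _ hu' κ, zero_mul]
  -- the shift `z ↦ z + e_κ` in the first summand
  have hshift : ∀ κ : Fin (d + 1), ∑' z, pmBm (toSite r) N κ' x κ z * f (z + unitVec κ) =
      ∑' u, pmBm (toSite r) N κ' x κ (u - unitVec κ) * f u := by
    intro κ
    rw [← (Equiv.subRight (unitVec κ)).tsum_eq (fun z => pmBm (toSite r) N κ' x κ z * f (z + unitVec κ))]
    refine tsum_congr fun u => ?_
    simp only [Equiv.subRight_apply, sub_add_cancel]
  calc ∑' z, ∑ κ : Fin (d + 1), pmBm (toSite r) N κ' x κ z * dz f κ z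
      = ∑' z, ∑ κ : Fin (d + 1), (pmBm (toSite r) N κ' x κ z * f (z + unitVec κ) - pmBm (toSite r) N κ' x κ z * f z) := by
        refine tsum_congr fun z => Finset.sum_congr rfl fun κ _ => ?_
        simp only [AffineAveraging.dz, mul_sub]
    _ = ∑ κ : Fin (d + 1), ∑' z, (pmBm (toSite r) N κ' x κ z * f (z + unitVec κ) - pmBm (toSite r) N κ' x κ z * f z) :=
        Summable.tsum_finsetSum fun κ _ => (h1 κ).sub (h2 κ)
    _ = ∑ κ : Fin (d + 1), ((∑' u, pmBm (toSite r) N κ' x κ (u - unitVec κ) * f u) - ∑' u, pmBm (toSite r) N κ' x κ u * f u) := by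
        refine Finset.sum_congr rfl fun κ _ => ?_
        rw [(h1 κ).tsum_sub (h2 κ), hshift κ]
    _ = ∑ κ : Fin (d + 1), ∑' u, (pmBm (toSite r) N κ' x κ (u - unitVec κ) * f u - pmBm (toSite r) N κ' x κ u * f u) := by
        refine Finset.sum_congr rfl fun κ _ => ?_
        rw [(h3 κ).tsum_sub (h2 κ)]
    _ = ∑' u, ∑ κ : Fin (d + 1), (pmBm (toSite r) N κ' x κ (u - unitVec κ) * f u - pmBm (toSite r) N κ' x κ u * f u) :=
        (Summable.tsum_finsetSum fun κ _ => (h3 κ).sub (h2 κ)).symm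
    _ = ∑' u, codiff₁ (rowBm (toSite r) N κ' x) u * f u := by
        refine tsum_congr fun u => ?_
        simp only [AffineAveraging.codiff₁, rowBm_apply, Finset.sum_mul, sub_mul]

/-- [folklore] **THE CODIFFERENTIAL OF A ROW OF `Π_bm` PAIRED WITH ANY FUNCTION** (any root offset, `N ≥ 1`):
`Σ'_u codiff₁ (rowBm ρ N κ′ x) u · f u = dz (blockMeanAt N f) κ′ x` — by `codiff₁_rowBm` the codifferential is `N^{−(d+1)}` times the
difference of the indicators of the blocks of `x + e_{κ′}` and `x`. -/
theorem tsum_codiff_rowBm_mul (ρ : Fin (d + 1) → ℤ) (hN : 1 ≤ N) (f : Form0 (d + 1) ℝ) (κ' : Fin (d + 1)) (x : Fin (d + 1) → ℤ) :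
    ∑' u, codiff₁ (rowBm ρ N κ' x) u * f u = dz (blockMeanAt N f) κ' x := by
  classical
  have e : ∀ u, codiff₁ (rowBm ρ N κ' x) u * f u =
      (if blk N u = blk N (x + unitVec κ') then ((N : ℝ) ^ (d + 1))⁻¹ * f u else 0) -
        (if blk N u = blk N x then ((N : ℝ) ^ (d + 1))⁻¹ * f u else 0) := by
    intro u
    rw [codiff₁_rowBm ρ hN]
    simp only [AffineAveraging.dz, blockMeanAt_ind hN, sub_mul, ite_mul, zero_mul]
  rw [tsum_congr e, (summable_ite_blk hN _ _).tsum_sub (summable_ite_blk hN _ _),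
    tsum_ite_blk_eq_blockSum hN, tsum_ite_blk_eq_blockSum hN]
  simp only [AffineAveraging.dz, blockMeanAt, AffineAveraging.blockSum, ← Finset.mul_sum, div_eq_inv_mul]

/-- [folklore] **A ROW OF `Π_bm` PAIRED WITH A GRADIENT — THE MATRIX TWIN OF `axProjBmAt_dz`** (in-block root, EVERY `f`, no support
hypothesis): `Σ'_z Σ_κ pmBm (toSite r) N κ′ x κ z · dz f κ z = dz (blockMeanAt N f) κ′ x`. -/
theorem tsum_pmBm_dz (hN : 1 ≤ N) {r : Fin (d + 1) → ℕ} (hr : r ∈ box (d + 1) N) (f : Form0 (d + 1) ℝ) (κ' : Fin (d + 1))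
    (x : Fin (d + 1) → ℤ) :
    ∑' z, ∑ κ : Fin (d + 1), pmBm (toSite r) N κ' x κ z * dz f κ z = dz (blockMeanAt N f) κ' x := by
  rw [tsum_pmBm_dz_eq_tsum_codiff hN hr, tsum_codiff_rowBm_mul _ hN]

/-- [folklore] **WINDOW FORM** (the shape produced by `comp (trK piKBm) ·` and `tsum_window'`):
`Σ_{v ∈ cube} Σ_κ pmBm (toSite r) N κ′ x κ (x − v) · dz f κ (x − v) = dz (blockMeanAt N f) κ′ x`. -/
theorem sum_window_pmBm_dz (hN : 1 ≤ N) {r : Fin (d + 1) → ℕ} (hr : r ∈ box (d + 1) N) (f : Form0 (d + 1) ℝ) (κ' : Fin (d + 1))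
    (x : Fin (d + 1) → ℤ) :
    ∑ v ∈ cube (d + 1) N, ∑ κ : Fin (d + 1), pmBm (toSite r) N κ' x κ (x - v) * dz f κ (x - v) = dz (blockMeanAt N f) κ' x := by
  rw [← tsum_pmBm_dz hN hr f κ' x,
    ← tsum_window' N x (fun z => ∑ κ : Fin (d + 1), pmBm (toSite r) N κ' x κ z * dz f κ z)]
  refine tsum_congr fun z => ?_
  split_ifs with h
  · rfl
  · exact (Finset.sum_eq_zero fun κ _ => by rw [pmBm_eq_zero_of_not_mem_window hN hr κ' x κ z h, zero_mul]).symm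

/-- [folklore] **CONSTANT BLOCK SUMS ⇒ THE BLOCK MEAN HAS NO GRADIENT**: if every block sum of `f` equals `c` then `dz (blockMeanAt N f) = 0`
(block-sum-FREE functions, `c = 0`, are the case of the 𝔫_av gauge legs). -/
theorem dz_blockMeanAt_eq_zero_of_blockSum_eq {f : Form0 (d + 1) ℝ} {c : ℝ} (hf : ∀ y, blockSum N f y = c) :
    dz (blockMeanAt N f) = 0 := by
  funext κ x
  simp only [AffineAveraging.dz, blockMeanAt, hf, sub_self, Pi.zero_apply]

/-- [folklore] **FORM LEVEL: `Π_bm (dz f) = 0` WHEN THE BLOCK SUMS OF `f` ARE CONSTANT** (any root offset, `N ≥ 1`; an2's `axProjBmAt_dz`). -/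
theorem axProjBmAt_dz_eq_zero_of_blockSum_eq (ρ : Fin (d + 1) → ℤ) (hN : 1 ≤ N) {f : Form0 (d + 1) ℝ} {c : ℝ}
    (hf : ∀ y, blockSum N f y = c) : axProjBmAt ρ N (dz f) = 0 := by
  rw [axProjBmAt_dz ρ hN, dz_blockMeanAt_eq_zero_of_blockSum_eq hf]

/-- [folklore] **A ROW OF `Π_bm` IS BLIND TO THE GRADIENT OF A FUNCTION WITH CONSTANT BLOCK SUMS** (window form). -/
theorem sum_window_pmBm_dz_eq_zero_of_blockSum_eq (hN : 1 ≤ N) {r : Fin (d + 1) → ℕ} (hr : r ∈ box (d + 1) N)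
    {f : Form0 (d + 1) ℝ} {c : ℝ} (hf : ∀ y, blockSum N f y = c) (κ' : Fin (d + 1)) (x : Fin (d + 1) → ℤ) :
    ∑ v ∈ cube (d + 1) N, ∑ κ : Fin (d + 1), pmBm (toSite r) N κ' x κ (x - v) * dz f κ (x - v) = 0 := by
  rw [sum_window_pmBm_dz hN hr, dz_blockMeanAt_eq_zero_of_blockSum_eq hf, Pi.zero_apply, Pi.zero_apply]

end Matrix

/-! ## §2 Kernel level: `piKBmᵀ ∘ G`, `G ∘ piKBm` and the co-dressing on gradient columns ∕ rows -/

section Kernel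

/-- [folklore] **MULTIPLIER ROWS PASS THROUGH `piKBmᵀ ∘ ·`** (the multiplier block of `piKBm` is the identity). -/
theorem comp_trK_piKBm_inr (ρ : Fin (d + 1) → ℤ) (N : ℕ) (G : MKer (d + 1) (Fib d)) (x y : Fin (d + 1) → ℤ) (m : Fin (d + 1))
    (b : Fib d) : comp (trK (piKBm ρ N)) G x y (Sum.inr m) b = G x y (Sum.inr m) b := by
  have h : comp (trK (piKBm ρ N)) G = trK (comp (trK G) (piKBm ρ N)) := by
    rw [trK_comp]
    rfl
  rw [h]
  show comp (trK G) (piKBm ρ N) y x b (Sum.inr m) = G x y (Sum.inr m) b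
  rw [comp_piKBm_inr]
  rfl

/-- [folklore] **THE FIELD ROWS OF `piKBmᵀ ∘ G` ON A GRADIENT COLUMN — KERNEL TWIN OF `axProjBmAt_dz`** (in-block root): if the column
`(y, b)` of `G`, read on its field rows, is `dz f`, then `(piKBmᵀ ∘ G)(x, inl κ′; y, b) = dz (blockMeanAt N f) κ′ x`. -/
theorem comp_trK_piKBm_inl_of_col_eq_dz (hN : 1 ≤ N) {r : Fin (d + 1) → ℕ} (hr : r ∈ box (d + 1) N) (G : MKer (d + 1) (Fib d))
    {y : Fin (d + 1) → ℤ} {b : Fib d} {f : Form0 (d + 1) ℝ} (hG : ∀ κ z, G z y (Sum.inl κ) b = dz f κ z)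
    (x : Fin (d + 1) → ℤ) (κ' : Fin (d + 1)) :
    comp (trK (piKBm (toSite r) N)) G x y (Sum.inl κ') b = dz (blockMeanAt N f) κ' x := by
  unfold ExpKernelCalculus.comp
  have e : ∀ z, ∑ f' : Fib d, trK (piKBm (toSite r) N) x z (Sum.inl κ') f' * G z y f' b =
      if x - z ∈ cube (d + 1) N then ∑ κ : Fin (d + 1), pmBm (toSite r) N κ' x κ z * G z y (Sum.inl κ) b else 0 := fun z =>
    sum_piKBm_col_inl (toSite r) N z x κ' (fun f' => G z y f' b)
  simp_rw [e]
  rw [tsum_window']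
  simp_rw [hG]
  exact sum_window_pmBm_dz hN hr f κ' x

/-- [folklore] **`piKBmᵀ ∘ G = 0` FOR A KERNEL WHOSE FIELD COLUMNS ARE GRADIENTS OF FUNCTIONS WITH CONSTANT BLOCK SUMS AND WHOSE MULTIPLIER
ROWS VANISH** (in-block root) — `Π_bm` is blind to the 𝔫_av gauge legs. -/
theorem comp_trK_piKBm_eq_zero_of_gradCols (hN : 1 ≤ N) {r : Fin (d + 1) → ℕ} (hr : r ∈ box (d + 1) N) {G : MKer (d + 1) (Fib d)}
    (hcol : ∀ (y : Fin (d + 1) → ℤ) (b : Fib d), ∃ (f : Form0 (d + 1) ℝ) (c : ℝ),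
      (∀ Y, blockSum N f Y = c) ∧ ∀ κ z, G z y (Sum.inl κ) b = dz f κ z)
    (hinr : ∀ (x y : Fin (d + 1) → ℤ) (m : Fin (d + 1)) (b : Fib d), G x y (Sum.inr m) b = 0) :
    comp (trK (piKBm (toSite r) N)) G = 0 := by
  funext x y a b
  rcases a with κ' | m
  · obtain ⟨f, c, hf, hG⟩ := hcol y b
    rw [comp_trK_piKBm_inl_of_col_eq_dz hN hr G hG, dz_blockMeanAt_eq_zero_of_blockSum_eq hf]
    rfl
  · rw [comp_trK_piKBm_inr, hinr]
    rfl

/-- [folklore] `0 ∘ M = 0` (termwise). -/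
theorem zero_comp (M : MKer (d + 1) (Fib d)) : comp (0 : MKer (d + 1) (Fib d)) M = 0 := by
  funext x z a b
  simp [ExpKernelCalculus.comp]

/-- [folklore] **THE CO-DRESSING KILLS SUCH A KERNEL**: `coDressKBmAt (toSite r) N G = piKBmᵀ ∘ G ∘ piKBm = 0`. -/
theorem coDressKBmAt_eq_zero_of_gradCols (hN : 1 ≤ N) {r : Fin (d + 1) → ℕ} (hr : r ∈ box (d + 1) N) {G : MKer (d + 1) (Fib d)}
    (hcol : ∀ (y : Fin (d + 1) → ℤ) (b : Fib d), ∃ (f : Form0 (d + 1) ℝ) (c : ℝ),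
      (∀ Y, blockSum N f Y = c) ∧ ∀ κ z, G z y (Sum.inl κ) b = dz f κ z)
    (hinr : ∀ (x y : Fin (d + 1) → ℤ) (m : Fin (d + 1)) (b : Fib d), G x y (Sum.inr m) b = 0) :
    coDressKBmAt (toSite r) N G = 0 := by
  rw [coDressKBmAt_eq, comp_trK_piKBm_eq_zero_of_gradCols hN hr hcol hinr, zero_comp]

/-- [folklore] **SECOND-LEG ∕ TRANSPOSED FORM: `G ∘ piKBm = 0` FOR A KERNEL WHOSE FIELD ROWS ARE GRADIENTS OF FUNCTIONS WITH CONSTANT BLOCK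
SUMS AND WHOSE MULTIPLIER COLUMNS VANISH.** -/
theorem comp_piKBm_eq_zero_of_gradRows (hN : 1 ≤ N) {r : Fin (d + 1) → ℕ} (hr : r ∈ box (d + 1) N) {G : MKer (d + 1) (Fib d)}
    (hrow : ∀ (x : Fin (d + 1) → ℤ) (a : Fib d), ∃ (f : Form0 (d + 1) ℝ) (c : ℝ),
      (∀ Y, blockSum N f Y = c) ∧ ∀ β y, G x y a (Sum.inl β) = dz f β y)
    (hinr : ∀ (x y : Fin (d + 1) → ℤ) (a : Fib d) (m : Fin (d + 1)), G x y a (Sum.inr m) = 0) :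
    comp G (piKBm (toSite r) N) = 0 := by
  have h : comp G (piKBm (toSite r) N) = trK (comp (trK (piKBm (toSite r) N)) (trK G)) := by
    rw [trK_comp]
    rfl
  rw [h, comp_trK_piKBm_eq_zero_of_gradCols hN hr (fun x a => hrow x a) (fun y x m a => hinr x y a m)]
  rfl

/-- [folklore] **SUBTRACTING A GAUGE TERM DOES NOT CHANGE THE CO-DRESSED KERNEL**: for tame `K`, `G` with `G` as above,
`coDressKBmAt (toSite r) N (K − G) = coDressKBmAt (toSite r) N K` — the socket for (D-Γ) `Gam = Γ_R − d∘𝔅∘δ` (NOT asserted here). -/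
theorem coDressKBmAt_sub_of_gradCols (hN : 1 ≤ N) {r : Fin (d + 1) → ℕ} (hr : r ∈ box (d + 1) N) {K G : MKer (d + 1) (Fib d)}
    (hK : Tame K) (hGt : Tame G)
    (hcol : ∀ (y : Fin (d + 1) → ℤ) (b : Fib d), ∃ (f : Form0 (d + 1) ℝ) (c : ℝ),
      (∀ Y, blockSum N f Y = c) ∧ ∀ κ z, G z y (Sum.inl κ) b = dz f κ z)
    (hinr : ∀ (x y : Fin (d + 1) → ℤ) (m : Fin (d + 1)) (b : Fib d), G x y (Sum.inr m) b = 0) :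
    coDressKBmAt (toSite r) N (K - G) = coDressKBmAt (toSite r) N K := by
  rw [coDressKBmAt_eq, coDressKBmAt_eq, comp_sub_right_tame (spr_trK_piKBm hN hr).tame hK hGt,
    comp_trK_piKBm_eq_zero_of_gradCols hN hr hcol hinr, sub_zero]

/-- [folklore] The same for a sum: `coDressKBmAt (toSite r) N (K + G) = coDressKBmAt (toSite r) N K`. -/
theorem coDressKBmAt_add_of_gradCols (hN : 1 ≤ N) {r : Fin (d + 1) → ℕ} (hr : r ∈ box (d + 1) N) {K G : MKer (d + 1) (Fib d)}
    (hK : Tame K) (hGt : Tame G)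
    (hcol : ∀ (y : Fin (d + 1) → ℤ) (b : Fib d), ∃ (f : Form0 (d + 1) ℝ) (c : ℝ),
      (∀ Y, blockSum N f Y = c) ∧ ∀ κ z, G z y (Sum.inl κ) b = dz f κ z)
    (hinr : ∀ (x y : Fin (d + 1) → ℤ) (m : Fin (d + 1)) (b : Fib d), G x y (Sum.inr m) b = 0) :
    coDressKBmAt (toSite r) N (K + G) = coDressKBmAt (toSite r) N K := by
  rw [coDressKBmAt_eq, coDressKBmAt_eq, comp_add_right_tame (spr_trK_piKBm hN hr).tame hK hGt,
    comp_trK_piKBm_eq_zero_of_gradCols hN hr hcol hinr, add_zero]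

end Kernel

/-! ## §3 The (D-Π) shape: the bi-gradient kernel `d∘X∘δ` of a scalar kernel with block-sum-free columns ∕ rows -/

section BiGrad

/-- [folklore] The bi-gradient of a scalar kernel, read as a column on the field rows, is the gradient of `z ↦ X z (y+e_l) − X z y`. -/
theorem biGrad_col_eq_dz (X : (Fin (d + 1) → ℤ) → (Fin (d + 1) → ℤ) → ℝ) (l : Fin (d + 1)) (y : Fin (d + 1) → ℤ)
    (κ : Fin (d + 1)) (z : Fin (d + 1) → ℤ) :
    X (z + unitVec κ) (y + unitVec l) - X (z + unitVec κ) y - X z (y + unitVec l) + X z y =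
      dz (fun w => X w (y + unitVec l) - X w y) κ z := by
  simp only [AffineAveraging.dz]
  ring

/-- [folklore] Block sums of a column difference of a kernel with block-sum-free columns vanish. -/
theorem blockSum_col_sub_eq_zero {X : (Fin (d + 1) → ℤ) → (Fin (d + 1) → ℤ) → ℝ}
    (hX : ∀ y' Y, blockSum N (fun w => X w y') Y = 0) (y y'' : Fin (d + 1) → ℤ) (Y : Fin (d + 1) → ℤ) :
    blockSum N (fun w => X w y - X w y'') Y = 0 := by
  have h := hX y Y
  have h' := hX y'' Y
  simp only [AffineAveraging.blockSum] at h h' ⊢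
  rw [Finset.sum_sub_distrib, h, h', sub_zero]

/-- [folklore] **(D-Π), FIRST LEG: `piKBmᵀ ∘ (d∘X∘δ) = 0`** for a scalar kernel `X` with block-sum-free COLUMNS — `G` is any fibred kernel whose
field–field block is the bi-gradient of `X` and whose other blocks vanish (in-block root). -/
theorem comp_trK_piKBm_biGrad_eq_zero (hN : 1 ≤ N) {r : Fin (d + 1) → ℕ} (hr : r ∈ box (d + 1) N)
    {X : (Fin (d + 1) → ℤ) → (Fin (d + 1) → ℤ) → ℝ} (hX : ∀ y' Y, blockSum N (fun w => X w y') Y = 0) {G : MKer (d + 1) (Fib d)}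
    (hG : ∀ x y κ l, G x y (Sum.inl κ) (Sum.inl l) = X (x + unitVec κ) (y + unitVec l) - X (x + unitVec κ) y - X x (y + unitVec l) + X x y)
    (hG0r : ∀ x y m b, G x y (Sum.inr m) b = 0) (hG0c : ∀ x y κ m, G x y (Sum.inl κ) (Sum.inr m) = 0) :
    comp (trK (piKBm (toSite r) N)) G = 0 := by
  refine comp_trK_piKBm_eq_zero_of_gradCols hN hr (fun y b => ?_) hG0r
  rcases b with l | m
  · exact ⟨fun w => X w (y + unitVec l) - X w y, 0, blockSum_col_sub_eq_zero hX _ _, fun κ z => by rw [hG, biGrad_col_eq_dz]⟩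
  · exact ⟨0, 0, fun Y => by simp [AffineAveraging.blockSum], fun κ z => by rw [hG0c]; simp [AffineAveraging.dz]⟩

/-- [folklore] **(D-Π), CO-DRESSING: `coDressKBmAt ρ N (d∘X∘δ) = 0`** (block-sum-free columns of `X`). -/
theorem coDressKBmAt_biGrad_eq_zero (hN : 1 ≤ N) {r : Fin (d + 1) → ℕ} (hr : r ∈ box (d + 1) N)
    {X : (Fin (d + 1) → ℤ) → (Fin (d + 1) → ℤ) → ℝ} (hX : ∀ y' Y, blockSum N (fun w => X w y') Y = 0) {G : MKer (d + 1) (Fib d)}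
    (hG : ∀ x y κ l, G x y (Sum.inl κ) (Sum.inl l) = X (x + unitVec κ) (y + unitVec l) - X (x + unitVec κ) y - X x (y + unitVec l) + X x y)
    (hG0r : ∀ x y m b, G x y (Sum.inr m) b = 0) (hG0c : ∀ x y κ m, G x y (Sum.inl κ) (Sum.inr m) = 0) :
    coDressKBmAt (toSite r) N G = 0 := by
  rw [coDressKBmAt_eq, comp_trK_piKBm_biGrad_eq_zero hN hr hX hG hG0r hG0c, zero_comp]

/-- [folklore] The bi-gradient read as a ROW on the field columns is the gradient of `w ↦ X (x+e_κ) w − X x w`. -/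
theorem biGrad_row_eq_dz (X : (Fin (d + 1) → ℤ) → (Fin (d + 1) → ℤ) → ℝ) (κ : Fin (d + 1)) (x : Fin (d + 1) → ℤ)
    (l : Fin (d + 1)) (y : Fin (d + 1) → ℤ) :
    X (x + unitVec κ) (y + unitVec l) - X (x + unitVec κ) y - X x (y + unitVec l) + X x y =
      dz (fun w => X (x + unitVec κ) w - X x w) l y := by
  simp only [AffineAveraging.dz]
  ring

/-- [folklore] **(D-Π), SECOND LEG: `(d∘X∘δ) ∘ piKBm = 0`** for a scalar kernel `X` with block-sum-free ROWS. -/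
theorem comp_piKBm_biGrad_eq_zero (hN : 1 ≤ N) {r : Fin (d + 1) → ℕ} (hr : r ∈ box (d + 1) N)
    {X : (Fin (d + 1) → ℤ) → (Fin (d + 1) → ℤ) → ℝ} (hX : ∀ x' Y, blockSum N (fun w => X x' w) Y = 0) {G : MKer (d + 1) (Fib d)}
    (hG : ∀ x y κ l, G x y (Sum.inl κ) (Sum.inl l) = X (x + unitVec κ) (y + unitVec l) - X (x + unitVec κ) y - X x (y + unitVec l) + X x y)
    (hG0r : ∀ x y m b, G x y (Sum.inr m) b = 0) (hG0c : ∀ x y κ m, G x y (Sum.inl κ) (Sum.inr m) = 0) :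
    comp G (piKBm (toSite r) N) = 0 := by
  refine comp_piKBm_eq_zero_of_gradRows hN hr (fun x a => ?_) (fun x y a m => ?_)
  · rcases a with κ | m
    · refine ⟨fun w => X (x + unitVec κ) w - X x w, 0, fun Y => ?_, fun l y => by rw [hG, biGrad_row_eq_dz]⟩
      have h := hX (x + unitVec κ) Y
      have h' := hX x Y
      simp only [AffineAveraging.blockSum] at h h' ⊢
      rw [Finset.sum_sub_distrib, h, h', sub_zero]
    · exact ⟨0, 0, fun Y => by simp [AffineAveraging.blockSum], fun l y => by rw [hG0r]; simp [AffineAveraging.dz]⟩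
  · rcases a with κ | m'
    · exact hG0c x y κ m
    · exact hG0r x y m' _

/-- [folklore] **(D-Π), THE SOCKET FOR THE DICTIONARY: `coDressKBmAt ρ N (K − d∘X∘δ) = coDressKBmAt ρ N K`** for tame `K` and a tame
bi-gradient kernel `G` of a scalar kernel `X` with block-sum-free columns — once (D-Γ) supplies `KInv n = K_R − G` of this shape (NOT asserted
here), the bi-Laplacian gauge term drops out of the co-dressed legs `coDressKBmAt ρ_c n (KInv n)` of the literal of record. -/
theorem coDressKBmAt_sub_biGrad (hN : 1 ≤ N) {r : Fin (d + 1) → ℕ} (hr : r ∈ box (d + 1) N) {K G : MKer (d + 1) (Fib d)}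
    (hK : Tame K) (hGt : Tame G)
    {X : (Fin (d + 1) → ℤ) → (Fin (d + 1) → ℤ) → ℝ} (hX : ∀ y' Y, blockSum N (fun w => X w y') Y = 0)
    (hG : ∀ x y κ l, G x y (Sum.inl κ) (Sum.inl l) = X (x + unitVec κ) (y + unitVec l) - X (x + unitVec κ) y - X x (y + unitVec l) + X x y)
    (hG0r : ∀ x y m b, G x y (Sum.inr m) b = 0) (hG0c : ∀ x y κ m, G x y (Sum.inl κ) (Sum.inr m) = 0) :
    coDressKBmAt (toSite r) N (K - G) = coDressKBmAt (toSite r) N K := by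
  rw [coDressKBmAt_eq, coDressKBmAt_eq, comp_sub_right_tame (spr_trK_piKBm hN hr).tame hK hGt,
    comp_trK_piKBm_biGrad_eq_zero hN hr hX hG hG0r hG0c, sub_zero]

end BiGrad

end

end Summit.QuantumFields.BalabanUV.Beta.D1BFx.BlockMeanBlindness
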